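import Mathlib
import Summits.Ventures.HodgeRepro.Tier4.Common.Automorphic
import Summits.Ventures.HodgeRepro.PeriodCloserC7Chain

/-!
# Tier4/Common/Chain — (P) on the endoscopic branch, from the landed chain, on the Tier-4 datum

Blind re-derivation cell `pub-hodge-repro`, Tier 4 (README §9–§10), seat t4-typer-2 (gen 0).  Target tree path
`lean/Summits/Ventures/HodgeRepro/Tier4/Common/Chain.lean`.  Imports `Tier4/Common/Automorphic.lean` (the bridge
`EndoscopicSide.toC7Face` with `toC7Face_P : E.toC7Face.P ↔ W.P`) and night-2's `PeriodCloserC7Chain.lean`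
(`S4face_of_chain`, whose proof passes through `I.P` without exporting it).

WHAT THIS FILE DOES.  Night-2's `S4face_of_chain (I : C7Face L) (H : ChainHypothesesAdm I) : I.S4face` reaches
S4 for the face THROUGH (P): base datum → even sign pattern → N2-compatible flip to (R1) → split-`𝔭` twist to
(R2) → (E1)–(E5) → (P′) by Borade et al. Thm 1.4 → (P) by the seesaw form of the identification → the Weil-period
witness → S4.  The step «→ (P)» is what Tier 4 asks for; it was never exported as a theorem.  This file exports it,
with EXACTLY the hypotheses it consumes (`PChainHypotheses I`: `seesaw : I.P ↔ I.P'`, TP1, BHTY Thm 1.1 +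
Lemma 4.11 (split), `Ξ_𝔭` infinite, Tate's product formula, the sign flip on admissible data, the local discharge
(E1)/(E2)/(E3)/(E5), the admissible family — Lemma Π, the witness `Y = f(X)` and the doubling form of the
identification are NOT used), as `P_of_chain`, and transports it to the Tier-4 sentence:
**`Witness.P_of_chain (E : EndoscopicSide L W Θ) (H : PChainHypotheses E.toC7Face) : W.P`**.

WHAT IT DOES NOT DO.  Every field of `PChainHypotheses` is a hypothesis; the theorem says «(P) follows from the
route's named inputs on any instantiation», exactly what the route claims and no more (the ONE unprinted input of
the route, the seesaw form (P) ⟺ (P′), is the field `seesaw`; the (R2)-side inputs are the printed statements named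
in their docstrings in `PeriodCloserC7.lean`).  Whether a `P_T4` may be stated with these as fields is the lead's
and the critics' question (crit-1 S11859 F3), not this file's.  Nothing here says anything about the status of the
Hodge conjecture for CM abelian varieties, which is NOT proved (HC_CM is NOT proved by anyone in this repository).
-/

set_option autoImplicit false

noncomputable section

namespace Summit.Ventures.HodgeRepro.PeriodCloser

open NumberField

variable {L : Type} [Field L] [NumberField L] [IsCMField L]

/-- **The hypotheses the chain consumes on the way to (P)** — `ChainHypothesesAdm` minus Lemma Π, the witness, and
the doubling form of the identification: the seesaw form `(P) ⟺ (P′)` (the ONE unprinted input), Borade et al.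
2025 Thm 1.4, BHTY 2025 Thm 1.1 and Lemma 4.11 (split case), `Ξ_𝔭` infinite, Tate's product formula, the sign
flip on admissible data, the local discharge and the admissible family (each as in `PeriodCloserC7.lean`). -/
structure PChainHypotheses (I : C7Face L) : Prop where
  /-- UNPRINTED: the seesaw form of the identification, (P) ⟺ (P′) -/
  seesaw : I.P ↔ I.P'
  /-- Borade et al. 2025 Thm 1.4 -/
  tp1 : Borade2025_Thm1_4 I
  /-- BHTY 2025 Thm 1.1 -/
  bhty : BHTY2025_Thm1_1 I
  /-- BHTY 2025 Lemma 4.11, split case -/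
  bhtySplit : BHTY2025_Lemma4_11_split I
  /-- `Ξ_𝔭` infinite; split ⟹ unramified -/
  xi : XiInfinite I
  /-- Tate's product formula -/
  productFormula : ProductFormula I
  /-- the sign flip of ROUTE-B §9.10, on admissible data -/
  flipAdm : FlipRootNumberAdm I
  /-- the local discharge -/
  discharge : LocalDischarge I
  /-- the admissible family -/
  family : AdmissibleFamily I

/-- The full chain bundle gives the (P)-bundle. -/
theorem ChainHypothesesAdm.toP (I : C7Face L) (H : ChainHypothesesAdm I) : PChainHypotheses I :=
  ⟨H.ident.seesaw, H.tp1, H.bhty, H.bhtySplit, H.xi, H.productFormula, H.flipAdm, H.discharge, H.family⟩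

/-- **(R1) ∧ (R2) on an admissible datum gives (P)** — the first half of `S4face_of_R1_R2`: (E1)–(E5) from the
local discharge and (R1)/(R2), (P′) by Borade et al. Thm 1.4, (P) by the seesaw. -/
theorem P_of_R1_R2 (I : C7Face L) (H : PChainHypotheses I) (d : I.Datum) (hd : I.Admissible d)
    (hR1 : I.R1 d) (hR2 : I.R2 d) : I.P := by
  have hEnd : I.Endoscopic d :=
    ⟨H.discharge.e1 d hd, H.discharge.e2_of_r1 d hd hR1, H.discharge.e3 d hd, hR2, H.discharge.e5 d hd⟩
  exact H.seesaw.mpr (P'_of_endoscopic I H.tp1 d hEnd)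

/-- **(P) on the endoscopic branch, from the named inputs** — the «→ (P)» step of night-2's `S4face_of_chain`,
exported: start from the base datum; its sign pattern is even (`signPattern_even`); flip the lines carrying `−1`
to reach (R1) (`exists_flip_to_trivial`, the sign flip on admissible data); twist along the split-`𝔭` family to a
common `ν` to reach (R2) with (R1) kept (`exists_common_twist`); then `P_of_R1_R2`. -/
theorem P_of_chain (I : C7Face L) (H : PChainHypotheses I) : I.P := by
  obtain ⟨d₀, hd₀⟩ := H.family.base
  have heven := signPattern_even I H.productFormula d₀ (H.discharge.e3 d₀ hd₀)
  obtain ⟨J, hJ, hJ1⟩ := exists_flip_to_trivial (I.signPattern d₀) heven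
  obtain ⟨d₁, hd₁, hchars₁⟩ := H.family.flip_mem d₀ J hd₀ hJ
  have hR1₁ : I.R1 d₁ := by
    intro j
    have hj := hJ1 j
    simp only [C7Face.signPattern] at hj
    rw [hchars₁]
    simp only [flipOn]
    by_cases hJj : J j = true
    · rw [if_pos hJj, H.flipAdm d₀ hd₀ j]
      rwa [if_pos hJj] at hj
    · rw [if_neg hJj]
      rwa [if_neg hJj] at hj
  obtain ⟨𝔭, h𝔭⟩ := H.family.split
  obtain ⟨ν, hν⟩ := exists_common_twist I H.bhty H.bhtySplit H.xi 𝔭 h𝔭 (I.chars d₁)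
    (H.family.selfDual d₁ hd₁) hR1₁
  obtain ⟨d₂, hd₂, hchars₂⟩ := H.family.twist_mem d₁ 𝔭 ν hd₁ h𝔭
  have hR1₂ : I.R1 d₂ := fun j => by
    rw [hchars₂]
    exact (hν j).1
  have hR2₂ : I.R2 d₂ := fun j => by
    show I.centralValue (I.chars d₂ j) ≠ 0
    rw [hchars₂]
    exact (hν j).2
  exact P_of_R1_R2 I H d₂ hd₂ hR1₂ hR2₂

/-- The same from the full chain bundle. -/
theorem P_of_chainHypothesesAdm (I : C7Face L) (H : ChainHypothesesAdm I) : I.P :=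
  P_of_chain I (ChainHypothesesAdm.toP I H)

end Summit.Ventures.HodgeRepro.PeriodCloser

namespace Summit.Ventures.HodgeRepro.Tier4.Common

open NumberField PeriodCloser

variable {L : Type} [Field L] [NumberField L] [IsCMField L]
  {Form : Type} [AddCommGroup Form] [Module ℂ Form] {A : FormAlgebra Form} {W : Witness A}
  {Θ : ThetaLifts W}

/-- **(P) — the Tier-4 sentence — from the route's named inputs on the Tier-4 datum**: `Witness.P` follows from
`PChainHypotheses` of the face interface `E.toC7Face` (whose `Datum` is «a choice of the Hecke translates» and
whose `hodgePairing` is `⟨f^*Ω_s, f^*Ω_{s̄}⟩_{L²(X)}`), through `toC7Face_P`. -/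
theorem Witness.P_of_chain (E : EndoscopicSide L W Θ) (H : PChainHypotheses E.toC7Face) : W.P :=
  E.toC7Face_P.mp (PeriodCloser.P_of_chain E.toC7Face H)

/-- The same with (R1) ∧ (R2) given on an admissible choice of translates. -/
theorem Witness.P_of_R1_R2 (E : EndoscopicSide L W Θ) (H : PChainHypotheses E.toC7Face) (γ : W.Translates)
    (hγ : E.Admissible γ) (hR1 : ∀ j : Fin 4, E.hecke.rootNumber (E.chars γ j) = 1)
    (hR2 : ∀ j : Fin 4, E.hecke.centralValue (E.chars γ j) ≠ 0) : W.P :=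
  E.toC7Face_P.mp (PeriodCloser.P_of_R1_R2 E.toC7Face H γ hγ hR1 hR2)

end Summit.Ventures.HodgeRepro.Tier4.Common

end
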